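import Summits.ResolutionOfSingularities.ResolutionOfSingularities.Theorems.WildPurityWildSymbolArcPlaces
import HarnessLib

/-!
# `WildSymbol` (stmt-ResolutionOfSingularities-17133), line `birth` — calibration II:
# rank-one places at which `K` is dense in its perfect hull absorb all of `H³_p(K)`

Support file for crux #2 of route `ResolutionOfSingularities/WildPurity`
(`Summit.ResolutionOfSingularities.ResolutionOfSingularities.Theses.WildPurity.WildSymbol`), line `birth`
(definitions `Theorems/WildPurityWildSymbolBirthDefs.lean`, calculus
`Theorems/WildPurityWildSymbolSymbolCalculus.lean`, `Theorems/WildPurityWildSymbolArcPlaces.lean`). Lead's calibration of the open stub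
`stub_selfSimilarGerm`, companion of `Theorems/WildPurityWildSymbolArcPlaces.lean` (discrete places with
perfect residue field). Registered sub-goal `not_wildSymbol_of_dense_in_perfect_hull`.

## The theorem

`unr_eq_top_of_dense_in_perfect_hull`: let `O` be a valuation ring of a field `K` of characteristic `p`
such that
* (a) `K = Kᵖ + O` — every `a ∈ K` is `eᵖ + n` with `n ∈ O`;
* (b) `Kˣ = (Kˣ)ᵖ · (1 + 𝔪_O)` — every `b ≠ 0` is `Bᵖ (1 + m)` with `m ∈ 𝔪_O`
  (the value group is `p`-divisible AND the residue field is perfect);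
* (c) archimedean bookkeeping — for `a ∈ K` and `0 ≠ m ∈ 𝔪_O` some `m^(pⁱ) · a` lies in `O`
  (automatic when `O` has rank one).
Then `Unr O = ⊤`: every class of Kato's symbolic `H³_p(K) = G ⧸ N` is a sum of `O`-integral symbols.
(a) and (b) say that `K` is DENSE IN ITS PERFECT HULL `K^{1/p}` for the valuation topology; by
Kuhlmann's classification (arXiv:1003.5639) these rank-one places are exactly the ones all of whose
Artin–Schreier defect extensions are INDEPENDENT ("deeply ramified" places).

Proof: by (b) a generator `[a, b, c}` equals `[a, 1+m, 1+m'}` (`sym_pow_p_mid` kills `[·, Bᵖ, ·}`).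
Claim, by induction on `i`: if `m^(pⁱ) a ∈ O` then `[a, 1+m, w} ∈ Unr O` for every unit `w`. For `i = 0`
reverse the unit shift: `[a, 1+m, w} = [a m/(1+m), m, w}` with `a m/(1+m) ∈ O`, and `m = Mᵖ(1+m₁)` makes it
`[a m/(1+m), 1+m₁, w}`, integral. For `i+1` use (a): `a = eᵖ + n`, so `[a, 1+m, w} = [e, 1+m, w} + [n, 1+m, w}`
by the Artin–Schreier relation `[eᵖ, ·, ·} = [e, ·, ·}` (`sym_frobenius`); the second term is integral and
`(m^(pⁱ) e)ᵖ = m^(p^(i+1)) a − m^(p^(i+1)) n ∈ O` gives `m^(pⁱ) e ∈ O` (valuation rings are root closed), so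
the induction hypothesis applies to `e`.

## Consequences (negative lemmas)

* `not_wildSymbol_of_dense_in_perfect_hull` — the crux with the extra hypotheses (a), (b), (c) on `O` is
  FALSE. Together with `ArcPlaces` this leaves, among RANK-ONE places `O`, only: discrete `O` with
  IMPERFECT residue field, non-discrete `O` with value group not `p`-divisible or residue field imperfect,
  and — the one remaining defect regime — `O` with `p`-divisible value group and perfect residue field at
  which `K` is NOT dense in `K^{1/p}` (Kuhlmann's DEPENDENT Artin–Schreier defect). For the line `birth`:
  a live self-similar germ with rank-one basin `T` (`v ∘ σ = λ v`, `λ < 1`) has `T` of this dependent-defect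
  type, or of rational rank `≥ 2` / imperfect residue field.

No definition is declared; nothing concludes the crux positively.
-/

noncomputable section

-- single-problem summit: the doubled namespace component `ResolutionOfSingularities` is forced
set_option linter.dupNamespace false

namespace Summit.ResolutionOfSingularities.ResolutionOfSingularities.Theorems.WildSymbol.Birth

variable {p : ℕ} {K : Type} [Field K]

set_option quotPrecheck false in
/-- `⟪a, b, c⟫` — the class of the symbol `[a, b, c}` in `G K ⧸ N p K` (local notation). -/
local notation "⟪" a ", " b ", " c "⟫" =>
  (((FreeAbelianGroup.of (((a : K), (b : Kˣ), (c : Kˣ)) : K × Kˣ × Kˣ) : G K)) : G K ⧸ N p K)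

/-! ## Two more consequences of the relations -/

/-- `[-a, b, c} = -[a, b, c}`. [folklore] -/
theorem sym_neg_left (a : K) (b c : Kˣ) : ⟪-a, b, c⟫ = -⟪a, b, c⟫ := by
  have h := sym_add_left (p := p) (-a) a b c
  rw [neg_add_cancel, sym_zero_left] at h
  exact eq_neg_of_add_eq_zero_left h.symm

/-- Subtraction in the first slot. [folklore] -/
theorem sym_sub_left (a a' : K) (b c : Kˣ) : ⟪a - a', b, c⟫ = ⟪a, b, c⟫ - ⟪a', b, c⟫ := by
  rw [sub_eq_add_neg, sym_add_left, sym_neg_left, ← sub_eq_add_neg]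

/-- **The Artin–Schreier relation** (shape (vii) of `N`): `[aᵖ, b, c} = [a, b, c}`. [cite: Kato1982, §1] -/
theorem sym_frobenius (a : K) (b c : Kˣ) : ⟪a ^ p, b, c⟫ = ⟪a, b, c⟫ := by
  have h : ((FreeAbelianGroup.of (a ^ p - a, b, c) : G K) : G K ⧸ N p K) = 0 :=
    (QuotientAddGroup.eq_zero_iff _).mpr (AddSubgroup.subset_closure
      (Or.inr (Or.inr (Or.inr (Or.inr (Or.inr (Or.inr ⟨a, b, c, rfl⟩)))))))
  rw [sym_sub_left, sub_eq_zero] at h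
  exact h

/-! ## Density in the perfect hull absorbs `H³_p` -/

/-- **Claim** (induction on the archimedean index `i`). Let `m ∈ 𝔪_O` be a non-zero non-unit with
`m = Mᵖ (1 + m₁)` available for every non-zero element (hypothesis (b)) and `K = Kᵖ + O` (hypothesis (a)).
If `m^(pⁱ) · a ∈ O` then `[a, 1 + m, w} ∈ Unr O` for every unit `w` of `O`. [folklore] -/
theorem sym_one_add_mem_Unr_of_pow_mul_mem [CharP K p] (hp : p ≠ 0) (O : ValuationSubring K)
    (ha : ∀ a : K, ∃ e n : K, n ∈ O ∧ a = e ^ p + n)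
    (hb : ∀ b : K, b ≠ 0 → ∃ B m : K, B ≠ 0 ∧ m ∈ O.nonunits ∧ b = B ^ p * (1 + m))
    (m : K) (hm : m ∈ O.nonunits) (hm0 : m ≠ 0) (t : Kˣ) (ht : (t : K) = 1 + m)
    (w : Kˣ) (hwO : (w : K) ∈ O) (hwu : (w : K) ∉ O.nonunits) (i : ℕ) :
    ∀ a : K, m ^ (p ^ i) * a ∈ O → ⟪a, t, w⟫ ∈ Unr p K O.toSubring := by
  have hmO : m ∈ O := O.nonunits_subset hm
  have htu : (t : K) ∉ O.nonunits := ht ▸ one_add_not_mem_nonunits O hm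
  have htO : (t : K) ∈ O := ht ▸ O.add_mem _ _ O.one_mem hmO
  obtain ⟨mu, hmu⟩ : ∃ mu : Kˣ, (mu : K) = m := ⟨Units.mk0 m hm0, rfl⟩
  induction i with
  | zero =>
    intro a hma
    rw [pow_zero, pow_one] at hma
    -- reverse unit shift: `[a, 1+m, w} = [a m/(1+m), m, w}`
    have hshift := sym_shift (p := p) (a * m * ↑t⁻¹) mu t w (by rw [ht, hmu])
    have e1 : a * m * ↑t⁻¹ * ↑mu⁻¹ * ↑t = a := by
      rw [Units.val_inv_eq_inv_val, Units.val_inv_eq_inv_val, hmu]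
      field_simp
    rw [e1] at hshift
    rw [← hshift]
    -- `m = Mᵖ (1 + m₁)`
    obtain ⟨M, m₁, hM0, hm₁, hmM⟩ := hb m hm0
    have h1m₁ : (1 : K) + m₁ ≠ 0 := ne_zero_of_not_mem_nonunits O (one_add_not_mem_nonunits O hm₁)
    obtain ⟨Mu, hMu⟩ : ∃ Mu : Kˣ, (Mu : K) = M := ⟨Units.mk0 M hM0, rfl⟩
    obtain ⟨t₁, ht₁⟩ : ∃ t₁ : Kˣ, (t₁ : K) = 1 + m₁ := ⟨Units.mk0 (1 + m₁) h1m₁, rfl⟩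
    have hmu' : mu = Mu ^ p * t₁ :=
      Units.ext (by rw [Units.val_mul, Units.val_pow_eq_pow_val, hmu, hMu, ht₁, hmM])
    rw [hmu', sym_mul_mid, sym_pow_p_mid, zero_add]
    have hm₁O : m₁ ∈ O := O.nonunits_subset hm₁
    refine sym_mem_Unr_of_units O ?_ (ht₁ ▸ O.add_mem _ _ O.one_mem hm₁O)
      (ht₁ ▸ one_add_not_mem_nonunits O hm₁) hwO hwu
    -- `a m / (1+m) ∈ O`
    have : a * m * ↑t⁻¹ = m * a * (t : K)⁻¹ := by rw [Units.val_inv_eq_inv_val, mul_comm a m]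
    rw [this]
    exact O.mul_mem _ _ hma (inv_mem_of_not_mem_nonunits O htu)
  | succ i ih =>
    intro a hma
    obtain ⟨e, n, hnO, hae⟩ := ha a
    -- `[a, t, w} = [e, t, w} + [n, t, w}` by the Artin–Schreier relation
    rw [hae, sym_add_left, sym_frobenius]
    refine (Unr p K O.toSubring).add_mem (ih e ?_) (sym_mem_Unr_of_units O hnO htO htu hwO hwu)
    -- `(m^(pⁱ) e)ᵖ = m^(p^(i+1)) a - m^(p^(i+1)) n ∈ O`, and `O` is root closed
    have hpow : (m ^ (p ^ i) * e) ^ p ∈ O := by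
      have : (m ^ (p ^ i) * e) ^ p = m ^ (p ^ (i + 1)) * a - m ^ (p ^ (i + 1)) * n := by
        rw [hae, mul_pow, ← pow_mul, ← pow_succ]; ring
      rw [this]
      exact O.toSubring.sub_mem hma (O.mul_mem _ _ (O.toSubring.pow_mem hmO _) hnO)
    -- root closedness of a valuation ring: `yᵖ ∈ O → y ∈ O`
    rcases O.mem_or_inv_mem (m ^ (p ^ i) * e) with h | h
    · exact h
    · by_cases h0 : m ^ (p ^ i) * e = 0
      · rw [h0]; exact O.zero_mem
      have hinv : ((m ^ (p ^ i) * e) ^ p)⁻¹ ∈ O := by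
        rw [← inv_pow]; exact O.toSubring.pow_mem h p
      -- both `x^p` and its inverse lie in `O`, so `x^p` is a unit, so `x` is (valuation = 1)
      have hv1 : O.valuation ((m ^ (p ^ i) * e) ^ p) = 1 := by
        apply le_antisymm ((O.valuation_le_one_iff _).mpr hpow)
        have h2 := (O.valuation_le_one_iff _).mpr hinv
        rw [map_inv₀, inv_le_one₀] at h2
        · exact h2
        · exact (Valuation.pos_iff _).mpr (pow_ne_zero _ h0)
      rw [map_pow] at hv1
      have hv : O.valuation (m ^ (p ^ i) * e) = 1 := (pow_eq_one_iff.mp hv1).resolve_right hp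
      exact (O.valuation_le_one_iff _).mp hv.le

/-- **Rank-one places at which `K` is dense in its perfect hull absorb `H³_p(K)`** (see the module
docstring for hypotheses (a), (b), (c) and the proof). [folklore] -/
theorem unr_eq_top_of_dense_in_perfect_hull [CharP K p] (hp : p ≠ 0) (O : ValuationSubring K)
    (ha : ∀ a : K, ∃ e n : K, n ∈ O ∧ a = e ^ p + n)
    (hb : ∀ b : K, b ≠ 0 → ∃ B m : K, B ≠ 0 ∧ m ∈ O.nonunits ∧ b = B ^ p * (1 + m))
    (hc : ∀ a m : K, m ∈ O.nonunits → m ≠ 0 → ∃ i : ℕ, m ^ (p ^ i) * a ∈ O) :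
    Unr p K O.toSubring = ⊤ := by
  apply eq_top_of_forall_sym_mem
  intro a b c
  -- `b = Bᵖ (1+m)`, `c = Cᵖ (1+m')`
  obtain ⟨B, m, hB0, hm, hbB⟩ := hb b b.ne_zero
  obtain ⟨C, m', hC0, hm', hcC⟩ := hb c c.ne_zero
  have h1m : (1 : K) + m ≠ 0 := ne_zero_of_not_mem_nonunits O (one_add_not_mem_nonunits O hm)
  have h1m' : (1 : K) + m' ≠ 0 := ne_zero_of_not_mem_nonunits O (one_add_not_mem_nonunits O hm')
  obtain ⟨Bu, hBu⟩ : ∃ Bu : Kˣ, (Bu : K) = B := ⟨Units.mk0 B hB0, rfl⟩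
  obtain ⟨Cu, hCu⟩ : ∃ Cu : Kˣ, (Cu : K) = C := ⟨Units.mk0 C hC0, rfl⟩
  obtain ⟨t, ht⟩ : ∃ t : Kˣ, (t : K) = 1 + m := ⟨Units.mk0 _ h1m, rfl⟩
  obtain ⟨t', ht'⟩ : ∃ t' : Kˣ, (t' : K) = 1 + m' := ⟨Units.mk0 _ h1m', rfl⟩
  have hb' : b = Bu ^ p * t := Units.ext (by rw [Units.val_mul, Units.val_pow_eq_pow_val, hBu, ht, hbB])
  have hc' : c = Cu ^ p * t' :=
    Units.ext (by rw [Units.val_mul, Units.val_pow_eq_pow_val, hCu, ht', hcC])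
  rw [hb', hc', sym_mul_mid, sym_pow_p_mid, zero_add, sym_mul_right, sym_antisymm a t (Cu ^ p),
    sym_pow_p_mid, neg_zero, zero_add]
  -- goal: `[a, 1+m, 1+m'} ∈ Unr O`
  have ht'O : (t' : K) ∈ O := ht' ▸ O.add_mem _ _ O.one_mem (O.nonunits_subset hm')
  have ht'u : (t' : K) ∉ O.nonunits := ht' ▸ one_add_not_mem_nonunits O hm'
  by_cases hm0 : m = 0
  · -- `t = 1`: the symbol vanishes
    have : t = 1 := Units.ext (by rw [ht, hm0, add_zero, Units.val_one])
    rw [this, sym_one_mid]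
    exact (Unr p K O.toSubring).zero_mem
  obtain ⟨i, hi⟩ := hc a m hm hm0
  exact sym_one_add_mem_Unr_of_pow_mul_mem hp O ha hb m hm hm0 t ht t' ht'O ht'u i a hi

/-- **CALIBRATION (negative lemma): no `WildSymbol` witness at a rank-one place where `K` is dense in its
perfect hull.** The crux with the extra hypotheses (a) `K = Kᵖ + O`, (b) `Kˣ = (Kˣ)ᵖ(1 + 𝔪_O)`,
(c) `∀ a, ∀ m ∈ 𝔪_O ∖ 0, ∃ i, m^(pⁱ) a ∈ O` on the valuation ring `O` is FALSE: such `O` absorb every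
class. These are non-discrete, non-Abhyankar, `p`-divisible places — the INDEPENDENT-defect half of the
Artin–Schreier defect world; what remains for a witness at a rank-one `p`-divisible place with perfect
residue field is Kuhlmann's DEPENDENT defect (`K` not dense in `K^{1/p}`). [folklore] -/
theorem not_wildSymbol_of_dense_in_perfect_hull :
    ¬ ∃ p : ℕ, p.Prime ∧ ∃ (k K : Type) (_ : Field k) (_ : CharP k p) (_ : PerfectField k) (_ : Field K)
      (_ : Algebra k K), (⊤ : IntermediateField k K).FG ∧ ∃ O : ValuationSubring K,
      (∀ c : k, algebraMap k K c ∈ O) ∧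
      (∀ a : K, ∃ e n : K, n ∈ O ∧ a = e ^ p + n) ∧
      (∀ b : K, b ≠ 0 → ∃ B m : K, B ≠ 0 ∧ m ∈ O.nonunits ∧ b = B ^ p * (1 + m)) ∧
      (∀ a m : K, m ∈ O.nonunits → m ≠ 0 → ∃ i : ℕ, m ^ (p ^ i) * a ∈ O) ∧
      ∃ R : Subalgebra k K, R.FG ∧ R.toSubring ≤ O.toSubring ∧ IsFractionRing R K ∧
      ∃ α : G K ⧸ N p K, DivIntegral p k K R O α ∧ α ∉ Unr p K O.toSubring := by
  rintro ⟨p, hp, k, K, _, _, _, _, _, -, O, -, ha, hb, hc, R, -, -, -, α, -, hα⟩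
  haveI : CharP K p := charP_of_injective_algebraMap (algebraMap k K).injective p
  rw [unr_eq_top_of_dense_in_perfect_hull hp.ne_zero O ha hb hc] at hα
  exact hα trivial

end Summit.ResolutionOfSingularities.ResolutionOfSingularities.Theorems.WildSymbol.Birth

end
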